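import Literature.InformationTheory.QuantumCodes.LatticeQuotientLocalityBound
import Literature.InformationTheory.QuantumCodes.AbelianTwoBlockDistanceBound
import Literature.Algebra.EuclideanLattices.SuccessiveMinimaHermiteConstant
import HarnessLib

/-!
# Weight-6 abelian two-block codes: `|G| ≥ 65536 ⟹ d ≤ 24·|G|^{3/4}`, conditional on
# Arnault–Gaborit–Rozendaal–Saussay–Zémor 2026 Thm. 4.1

Topic `Literature/InformationTheory/QuantumCodes` (venture QEC, cell `qec`, PARTITION row 06 / X1). One theorem,
PROVED modulo the named fact `ArnaultEtAl2026_theorem41` of `LatticeQuotientLocalityBound.lean` (taken as the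
hypothesis `h41`, so the result is CONDITIONAL and recorded as such): for every abelian two-block code
`AbelianTwoBlock.css a b` (GB `G = ℤ_ℓ`, BB `G = ℤ_ℓ × ℤ_m`, abelian 2BGA) with check weight `wt a + wt b = 6` and
`k ≥ 1`, `|G| ≥ 65536 ⟹ min(d_X, d_Z) ≤ 24·|G|^{3/4}`. The two numerical inputs are the tree's PROVED Hermite bound
`γ₄ ≤ 4` (`Literature.Algebra.EuclideanLattices.hermiteConstant_le_self`, Minkowski): it turns the printed threshold
`|G|^{1/4} ≥ 8√γ₄` into `|G| ≥ 16⁴` and the printed constant `2√γ₄(√4 + 4)` into `≤ 24`. With the true `γ₄ = √2`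
(Korkine–Zolotareff; not in the tree) the printed threshold is `|G| ≥ 8192` («Theorem 2.18 only applies for
`n ≥ 8192`» [PostemaKokkelmans2026, §2 after Thm. 2.19, arXiv:2502.17052 chunk p0014 L24–26]) and the constant
`≈ 14.3`. Vacuous for every census object (`|G| ≤ 144`); it is the explicit-constant shape an «asymptotic» sentence
about the weight-6 two-block census families would cite.

References: [ArnaultEtAl2026] F. Arnault, P. Gaborit, W. Rozendaal, N. Saussay, G. Zémor, *A Variant of the
Bravyi–Terhal Bound for Arbitrary Boundary Conditions*, IEEE Trans. Inform. Theory 72 (2026) 437–446 =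
arXiv:2502.04995, Thm. 4.1 (chunk p0010 L5–7); [PostemaKokkelmans2026] arXiv:2502.17052, §2 (chunk p0014 L24–26).
-/

namespace Literature.InformationTheory.QuantumCodes

open Literature.Algebra.EuclideanLattices

namespace AbelianTwoBlock

/-- **Weight-6 abelian two-block codes: `|G| ≥ 65536 ⟹ d ≤ 24·|G|^{3/4}`, CONDITIONAL on
`ArnaultEtAl2026_theorem41`.** For `D = 4` the printed hypothesis `|G|^{1/4} ≥ 8√γ₄` is implied by `|G| ≥ 16⁴ = 65536`
and the printed constant `2√γ₄(√4 + 4)` is at most `2·2·6 = 24`, both via the tree's PROVED `γ₄ ≤ 4`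
(`hermiteConstant_le_self`); with the true value `γ₄ = √2` (not in the tree) the printed threshold is `|G| ≥ 8192`
and the constant `2·2^{1/4}·6 ≈ 14.3` [PostemaKokkelmans2026, §2: «Theorem 2.18 only applies for n ≥ 8192»]. This is
the form an «asymptotic» sentence about the weight-6 two-block census families (GB `G = ℤ_ℓ`, BB `G = ℤ_ℓ × ℤ_m`,
abelian 2BGA) would cite; it is a CONDITIONAL result (hypothesis `h41` = the named fact), vacuous for every census
object (`|G| ≤ 144`). Column: proved (modulo the cited fact).
[cite: ArnaultEtAl2026, Thm. 4.1 (arXiv:2502.04995 chunk p0010 L5–7)] [cite: PostemaKokkelmans2026, §2 after Thm. 2.19 (arXiv:2502.17052 chunk p0014 L24–26)] -/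
theorem dX_le_of_ArnaultEtAl2026_theorem41 (h41 : ArnaultEtAl2026_theorem41) {G : Type} [Fintype G]
    [AddCommGroup G] (a b : G → ZMod 2) (hw : hammingNorm a + hammingNorm b = 6)
    (hk : 0 < (css a b).k) (hn : 65536 ≤ Fintype.card G) :
    ((min (css a b).dX (css a b).dZ : ℕ) : ℝ) ≤ 24 * (Fintype.card G : ℝ) ^ (3 / 4 : ℝ) := by
  have hγ0 : 0 ≤ hermiteConstant 4 := hermiteConstant_nonneg 4
  have hγ : Real.sqrt (hermiteConstant 4) ≤ 2 := by
    rw [show (2 : ℝ) = Real.sqrt (2 ^ 2) by rw [Real.sqrt_sq (by norm_num)]]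
    exact Real.sqrt_le_sqrt (by have := hermiteConstant_le_self 4; push_cast at this; linarith)
  have hs0 : 0 ≤ Real.sqrt (hermiteConstant 4) := Real.sqrt_nonneg _
  have hab : a ≠ 0 ∨ b ≠ 0 := by
    rcases eq_or_ne a 0 with rfl | ha
    · right
      rintro rfl
      simp at hw
    · exact Or.inl ha
  have hG0 : (0 : ℝ) ≤ Fintype.card G := Nat.cast_nonneg _
  have hG : (65536 : ℝ) ≤ Fintype.card G := by exact_mod_cast hn
  -- the printed threshold `8√γ₄ ≤ |G|^{1/4}` from `|G| ≥ 16⁴` and `γ₄ ≤ 4`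
  have hthr : 8 * Real.sqrt (hermiteConstant 4) ≤ (Fintype.card G : ℝ) ^ (1 / ((4 : ℕ) : ℝ)) := by
    have h16 : (16 : ℝ) = (65536 : ℝ) ^ (1 / ((4 : ℕ) : ℝ)) := by
      rw [show (65536 : ℝ) = 16 ^ (4 : ℝ) by norm_num, ← Real.rpow_mul (by norm_num)]
      norm_num
    calc 8 * Real.sqrt (hermiteConstant 4) ≤ 16 := by linarith
      _ = (65536 : ℝ) ^ (1 / ((4 : ℕ) : ℝ)) := h16
      _ ≤ (Fintype.card G : ℝ) ^ (1 / ((4 : ℕ) : ℝ)) :=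
          Real.rpow_le_rpow (by norm_num) hG (by norm_num)
  have h := h41 G a b 4 hab (by norm_num) hw hk hthr
  have hexp : (((4 : ℕ) : ℝ) - 1) / (4 : ℕ) = (3 / 4 : ℝ) := by norm_num
  rw [hexp] at h
  have hs4 : Real.sqrt ((4 : ℕ) : ℝ) = 2 := by
    rw [show ((4 : ℕ) : ℝ) = 2 ^ 2 by norm_num, Real.sqrt_sq (by norm_num)]
  rw [hs4] at h
  have hpow : 0 ≤ (Fintype.card G : ℝ) ^ (3 / 4 : ℝ) := Real.rpow_nonneg hG0 _
  calc ((min (css a b).dX (css a b).dZ : ℕ) : ℝ)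
      ≤ 2 * Real.sqrt (hermiteConstant 4) * (2 + 4) * (Fintype.card G : ℝ) ^ (3 / 4 : ℝ) := h
    _ ≤ 2 * 2 * (2 + 4) * (Fintype.card G : ℝ) ^ (3 / 4 : ℝ) := by gcongr
    _ = 24 * (Fintype.card G : ℝ) ^ (3 / 4 : ℝ) := by ring


/-- **Weight-6 abelian two-block codes: `|G| ≥ 65536 ⟹ d ≤ 24·|G|^{3/4}`, UNCONDITIONAL** — the
corollary `dX_le_of_ArnaultEtAl2026_theorem41` instantiated with the tree's proof
`ArnaultEtAl2026_theorem41_holds` (`AbelianTwoBlockDistanceBound.lean`): for every abelian two-block code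
`css a b` (GB, BB, abelian 2BGA) with `wt a + wt b = 6` and `k ≥ 1` on a group of order `|G| ≥ 65536`,
`min(d_X, d_Z) ≤ 24·|G|^{3/4}`. The constant `24` uses only the tree's `γ₄ ≤ 4`; with `γ₄ = √2` the printed
threshold is `8192` and the constant `≈ 14.3` [PostemaKokkelmans2026, §2]. Vacuous for every census object.
Column: proved.
[cite: ArnaultEtAl2026, Thm. 4.1 (arXiv:2502.04995 chunk p0010 L5–7)] [cite: PostemaKokkelmans2026, §2 after Thm. 2.19 (arXiv:2502.17052 chunk p0014 L24–26)] -/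
theorem min_dX_dZ_le_of_weight_six {G : Type} [Fintype G] [AddCommGroup G] (a b : G → ZMod 2)
    (hw : hammingNorm a + hammingNorm b = 6) (hk : 0 < (css a b).k) (hn : 65536 ≤ Fintype.card G) :
    ((min (css a b).dX (css a b).dZ : ℕ) : ℝ) ≤ 24 * (Fintype.card G : ℝ) ^ (3 / 4 : ℝ) :=
  dX_le_of_ArnaultEtAl2026_theorem41 ArnaultEtAl2026_theorem41_holds a b hw hk hn

end AbelianTwoBlock

end Literature.InformationTheory.QuantumCodes
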